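import Literature.Geometry.Kaehler.ComplexTorusThetaSections
import Literature.Geometry.Kaehler.ComplexTorusSiegelRiemannForm
import HarnessLib

/-!
# The metric of the principal polarisation: `log ‖ϑ‖ - π ᵗ(Im z)(Im Ω)⁻¹(Im z)` is lattice periodic

Layer `Literature/Geometry/Kaehler`, namespace `Literature.Geometry.Kaehler.ComplexTorus`; lane
`lit-hodgefound` (Track 2 foundations library), prover seat `lit-hodgefound-p07`, generation 19,
first rider towards FILE C (torus glue) of the programme «`[Θ_Ω] = -E_Ω` for every `Ω ∈ 𝔥_g`»
(Poincaré–Lelong for the theta divisor by the inequality route).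

Source followed: H. Lange, *Abelian Varieties over the Complex Numbers* (2023), §3.3.4 Exercise (4)
(the classical factor `e[0;0](λ, z) = e(-πi ᵗλ¹Ωλ¹ - 2πi ᵗλ¹ z)` of the Siegel torus, the tree's
`ComplexTorus.siegelFactor`) together with §1.2.3 / Lemma 3.2.? `‖·‖_h`: for a theta function `θ`
of the factor `e[0;0]` the function `h(z) = |θ(z)|² exp(-2π ᵗ(Im z)(Im Ω)⁻¹(Im z))` is
`Λ`-PERIODIC — it is the pointwise norm of the section `θ` for the hermitian metric of `L_Ω` whose
curvature is the principal polarisation `H_Ω = (Im Ω)⁻¹` (Griffiths–Harris, Ch. 2 §6, p. 310: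
"`h(z) = e^{-π ᵗy Y⁻¹ y}` defines a metric on `L`"). We prove exactly the periodicity, in
logarithmic form:

* `norm_siegelFactor` — `|e[0;0](λ, z)| = exp(π ᵗn (Im Ω) n + 2π ᵗn Im z)`, `n = λ¹` the `Ω`-part;
* `im_add_latticeVec` — `Im(z + λ) = Im z + (Im Ω) n`;
* `siegelMetricExponent_add_latticeVec` — `q(z + λ) = q(z) + 2 ᵗn Im z + ᵗn (Im Ω) n` for
  `q(z) = ᵗ(Im z)(Im Ω)⁻¹(Im z)`;
* `log_norm_sub_siegelMetricExponent_add_latticeVec` — for `θ ∈ thetaFunctions Φ (siegelFactor Ω)`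
  with `θ z ≠ 0`: `log ‖θ(z + λ)‖ - π q(z + λ) = log ‖θ z‖ - π q(z)`.

Theorems only; no definitions, no named facts.

## References

* [Lange2023AbelianVarietiesComplex] H. Lange, *Abelian Varieties over the Complex Numbers*,
  Springer (2023), §1.2.1 (1.8), §3.3.4 Exercise (4).
* [GriffithsHarrisPrinciples1978] P. Griffiths, J. Harris, *Principles of Algebraic Geometry*
  (1978), Ch. 2 §6, pp. 307–310 (the metric `e^{-π ᵗy Y⁻¹ y}` on the theta line bundle).
-/

noncomputable section

open Complex Matrix
open scoped Real

namespace Literature.Geometry.Kaehler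

namespace ComplexTorus

variable {n : ℕ} (Ω : Matrix (Fin n) (Fin n) ℂ)

/-- **`|e[0;0](λ, z)| = exp(π ᵗn (Im Ω) n + 2π ᵗn Im z)`** for the classical factor of the Siegel
torus, `n = λ¹ ∈ ℤⁿ` the `Ω`-part of `λ = λ² + Ωλ¹`. [cite: Lange2023AbelianVarietiesComplex,
§3.3.4 Exercise (4)] -/
theorem norm_siegelFactor (w : Fin n ⊕ Fin n → ℤ) (z : Fin n → ℂ) :
    ‖siegelFactor Ω w z‖ =
      Real.exp (π * ((fun i => (w (Sum.inr i) : ℝ)) ⬝ᵥ (siegelIm Ω *ᵥ fun i => (w (Sum.inr i) : ℝ))) +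
        2 * π * ((fun i => (w (Sum.inr i) : ℝ)) ⬝ᵥ fun i => (z i).im)) := by
  rw [siegelFactor_apply, Complex.norm_exp]
  congr 1
  simp only [sub_re, neg_re, mul_re, mul_im, ofReal_re, ofReal_im, I_re, I_im, re_sum, im_sum,
    intCast_re, intCast_im, re_ofNat, im_ofNat, dotProduct, mulVec, siegelIm_apply]
  ring_nf
  simp only [Finset.mul_sum, Finset.sum_mul]
  ring_nf

/-- `Im(z + λ) = Im z + (Im Ω) λ¹` for `λ = λ² + Ωλ¹ ∈ ℤⁿ ⊕ Ωℤⁿ`.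
[cite: Lange2023AbelianVarietiesComplex, §3.3.2 Lemma 3.3.4] -/
theorem im_add_latticeVec (Φ : (Fin n ⊕ Fin n → ℝ) ≃L[ℝ] (Fin n → ℂ))
    (hΦ : ∀ v i, Φ v i = (v (Sum.inl i) : ℂ) + ∑ j, Ω i j * (v (Sum.inr j) : ℂ))
    (w : Fin n ⊕ Fin n → ℤ) (z : Fin n → ℂ) :
    (fun i => ((z + latticeVec Φ w) i).im) =
      (fun i => (z i).im) + siegelIm Ω *ᵥ fun i => (w (Sum.inr i) : ℝ) := by
  funext i
  rw [Pi.add_apply, Pi.add_apply, latticeVec_siegel Ω Φ hΦ w i]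
  simp [mulVec, dotProduct, mul_im]

/-- For a symmetric real matrix `A`: `(A x) · y = x · (A y)`. [folklore] -/
private theorem symm_mulVec_dotProduct' {A : Matrix (Fin n) (Fin n) ℝ} (hA : Aᵀ = A)
    (x y : Fin n → ℝ) : (A *ᵥ x) ⬝ᵥ y = x ⬝ᵥ (A *ᵥ y) := by
  rw [dotProduct_comm, dotProduct_mulVec, ← mulVec_transpose, hA, dotProduct_comm]

/-- **The exponent of the metric shifts affinely under the lattice**: with
`q(z) = ᵗ(Im z)(Im Ω)⁻¹(Im z)`, `q(z + λ) = q(z) + 2 ᵗλ¹ Im z + ᵗλ¹ (Im Ω) λ¹`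
(`Ω` symmetric, `Im Ω ≻ 0`). [cite: GriffithsHarrisPrinciples1978, Ch. 2 §6 (p. 310)] -/
theorem siegelMetricExponent_add_latticeVec (hΩ : ∀ i j, Ω i j = Ω j i)
    (hpos : (Matrix.of fun i j => (Ω i j).im).PosDef) (Φ : (Fin n ⊕ Fin n → ℝ) ≃L[ℝ] (Fin n → ℂ))
    (hΦ : ∀ v i, Φ v i = (v (Sum.inl i) : ℂ) + ∑ j, Ω i j * (v (Sum.inr j) : ℂ))
    (w : Fin n ⊕ Fin n → ℤ) (z : Fin n → ℂ) :
    (fun i => ((z + latticeVec Φ w) i).im) ⬝ᵥ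
        (siegelImInv Ω *ᵥ fun i => ((z + latticeVec Φ w) i).im) =
      (fun i => (z i).im) ⬝ᵥ (siegelImInv Ω *ᵥ fun i => (z i).im) +
        2 * ((fun i => (w (Sum.inr i) : ℝ)) ⬝ᵥ fun i => (z i).im) +
        (fun i => (w (Sum.inr i) : ℝ)) ⬝ᵥ (siegelIm Ω *ᵥ fun i => (w (Sum.inr i) : ℝ)) := by
  set y : Fin n → ℝ := fun i => (z i).im with hy
  set m : Fin n → ℝ := fun i => (w (Sum.inr i) : ℝ) with hm
  have hWY : siegelImInv Ω * siegelIm Ω = 1 := siegelImInv_mul_siegelIm Ω hpos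
  have hYW : siegelIm Ω * siegelImInv Ω = 1 := mul_eq_one_comm.1 hWY
  rw [im_add_latticeVec Ω Φ hΦ w z]
  rw [mulVec_add, mulVec_mulVec, hWY, one_mulVec, add_dotProduct, dotProduct_add, dotProduct_add,
    symm_mulVec_dotProduct' (siegelIm_transpose Ω hΩ) m (siegelImInv Ω *ᵥ y), mulVec_mulVec, hYW,
    one_mulVec, symm_mulVec_dotProduct' (siegelIm_transpose Ω hΩ) m m, dotProduct_comm y m]
  ring

/-- **`log ‖θ‖ - π ᵗ(Im z)(Im Ω)⁻¹(Im z)` is lattice periodic** off the zero set: for every theta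
function `θ` of the classical factor `e[0;0]` of `X_Ω = ℂⁿ/(ℤⁿ ⊕ Ωℤⁿ)` (`Ω` symmetric,
`Im Ω ≻ 0`), every lattice vector `λ` and every `z` with `θ(z) ≠ 0`,
`log ‖θ(z + λ)‖ - π q(z + λ) = log ‖θ(z)‖ - π q(z)`, `q(z) = ᵗ(Im z)(Im Ω)⁻¹(Im z)` — the function
`h = |θ|² e^{-2π q}` is the (periodic) pointwise norm of the section `θ` for the hermitian metric of
curvature `H_Ω`. (At zeros of `θ` both logarithms vanish by convention and the identity reduces to
the affine shift of `q`.) [cite: GriffithsHarrisPrinciples1978, Ch. 2 §6 (p. 310);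
Lange2023AbelianVarietiesComplex, §3.3.4 Exercise (4)] -/
theorem log_norm_sub_siegelMetricExponent_add_latticeVec (hΩ : ∀ i j, Ω i j = Ω j i)
    (hpos : (Matrix.of fun i j => (Ω i j).im).PosDef) (Φ : (Fin n ⊕ Fin n → ℝ) ≃L[ℝ] (Fin n → ℂ))
    (hΦ : ∀ v i, Φ v i = (v (Sum.inl i) : ℂ) + ∑ j, Ω i j * (v (Sum.inr j) : ℂ))
    {θ : (Fin n → ℂ) → ℂ} (hθ : θ ∈ thetaFunctions Φ (siegelFactor Ω)) (w : Fin n ⊕ Fin n → ℤ)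
    {z : Fin n → ℂ} (hz : θ z ≠ 0) :
    Real.log ‖θ (z + latticeVec Φ w)‖ -
        π * ((fun i => ((z + latticeVec Φ w) i).im) ⬝ᵥ
          (siegelImInv Ω *ᵥ fun i => ((z + latticeVec Φ w) i).im)) =
      Real.log ‖θ z‖ - π * ((fun i => (z i).im) ⬝ᵥ (siegelImInv Ω *ᵥ fun i => (z i).im)) := by
  have he : siegelFactor Ω w z ≠ 0 := (isFactor_siegelFactor Ω hΩ Φ hΦ).ne_zero w z
  rw [hθ.2 w z, norm_mul, Real.log_mul (norm_ne_zero_iff.2 he) (norm_ne_zero_iff.2 hz),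
    norm_siegelFactor, Real.log_exp, siegelMetricExponent_add_latticeVec Ω hΩ hpos Φ hΦ w z]
  ring

end ComplexTorus

end Literature.Geometry.Kaehler
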